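import Mathlib
import Summits.NavierStokesRegularity.NavierStokesRegularity.Theorems.OrthantWakeDyadicBreakBelowOneSocket
import Summits.NavierStokesRegularity.NavierStokesRegularity.Theorems.OrthantWakeDyadicBreakBelowOneRegion
import Summits.NavierStokesRegularity.NavierStokesRegularity.Theorems.OrthantWakeDyadicBreakBelowOneTransportTools
import HarnessLib

/-!
# `OrthantWake.DyadicBreakBelowOne` — transport: a certified cubic 2-mode region at ratio `1+ε₀`
# gives the weighted a-priori bound of the socket, hence `¬ NoGlobalCascade ε₀ dyadicTable X₀`

Item stmt-NavierStokesRegularity-24644 (`OrthantWake.DyadicBreakBelowOne`, aside).  This file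
connects the abstract region theorem `dyadicRegion_le_one` (infinite weighted chain on a window)
with the tree's regular viscous lattice solutions of `dyadicTable` and with the socket
`not_noGlobalCascade_dyadicTable_of_weightBound` (tools: `dyadicTransport_shellZero_sign`,
`dyadicTransport_identity` in `OrthantWakeDyadicBreakBelowOneTransportTools.lean`):

* `dyadicTransport_weightBound` — given the certificate facts for `(ε₀, w, δ, θ, m, c)` (corner,
  star-shape, `hψ₁`, `hψ₂`), every regular `ν`-viscous lattice solution of `dyadicTable` from `X₀`
  on `[0,s]` obeys `b^{wn}|X_{0,n}(t)| ≤ (|X₀ 0| + 1)/δ` (scale `R = (|X₀ 0|+1)/δ`; deep shells are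
  small by Tao's weight bound (4.5)).
* `not_noGlobalCascade_dyadicTable_of_certificate` — with `w > 1/2`, the socket turns this into
  `∀ X₀, ¬ NoGlobalCascade ε₀ dyadicTable X₀`.

MODEL lattice statements (route OrthantWake, rung TL-M2Break); nothing here is a statement about
the Navier–Stokes equations; no crux or summit is proved.
-/

noncomputable section

set_option linter.dupNamespace false

namespace Summit.NavierStokesRegularity.NavierStokesRegularity.Theorems

open Set Filter Topology
open Literature.Analysis.FluidPDE.TaoCascade

/-! ## The weighted bound from a certificate -/

/-- **Certified region ⇒ weighted a-priori bound.**  Let `b = 1+ε₀`, `w ≤ 1`,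
`D = b^{5/2−3w}`, `K = b^{5/2−w}`, `V = b²`, and let `(δ, θ, m, c)` satisfy `0 < δ < θ ≤ 1`, `m ≥ 0`,
`c > 0`, the corner condition `D c ≥ 1`, the star-shape condition `V(1−δ) ≤ 3` and the certificate
inequalities `hψ₁`, `hψ₂` of `dyadicRegion_le_one`.  Then every regular `ν`-viscous (`ν > 0`)
lattice solution of `dyadicTable` from the one-shell datum `X₀` on a window `[0,s]`, non-negative
on the shells `≥ 1`, obeys `b^{wn}|X_{0,n}(t)| ≤ (|X₀ 0| + 1)/δ` for all `n ≥ 0`, `t ∈ [0,s]`.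
Proof: `dyadicRegion_le_one` for `Yₙ = b^{w(n−1)} a_{n−1}/R`, `R = (|X₀ 0|+1)/δ` (datum `≤ δ`),
with `N₀` from Tao's weight bound (4.5) (`b^{wk}|X_{0,k}| ≤ M b^{(w−10)k} ≤ δR` for large `k`),
positivity from `dyadicTransport_shellZero_sign` and the hypothesis, and the equation from
`dyadicTransport_identity`. MODEL lattice statement. [this file] -/
theorem dyadicTransport_weightBound {ε₀ w δ θ m c ν s : ℝ} {X₀ : Fin 4 → ℝ}
    {X : Fin 4 → ℤ → ℝ → ℝ}
    (hε₀ : 0 < ε₀) (hw1 : w ≤ 1)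
    (hδ0 : 0 < δ) (hδθ : δ < θ) (hθ1 : θ ≤ 1) (hm : 0 ≤ m) (hc0 : 0 < c)
    (hDc : 1 ≤ (1 + ε₀) ^ ((5 : ℝ) / 2 - 3 * w) * c)
    (hVδ : (1 + ε₀) ^ (2 : ℝ) * (1 - δ) ≤ 3)
    (hψ₁ : ∀ x : ℝ, 0 ≤ x → m * x + θ ≤ 1 →
      (1 + ε₀) ^ ((5 : ℝ) / 2 - w) *
          (x ^ 2 - (1 + ε₀) ^ ((5 : ℝ) / 2 - 3 * w) * (m * x + θ) *
            (c * ((m * x + θ - δ) / (1 - δ)) ^ 3)) +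
        m * (1 + ε₀) ^ ((5 : ℝ) / 2 - 3 * w) * x * (m * x + θ) ≤ 0)
    (hψ₂ : ∀ x : ℝ, δ < x → x ≤ 1 →
      3 * c * ((x - δ) / (1 - δ)) ^ 2 / (1 - δ) *
          (1 - (1 + ε₀) ^ ((5 : ℝ) / 2 - 3 * w) * x * (c * ((x - δ) / (1 - δ)) ^ 3)) -
        (1 + ε₀) ^ ((5 : ℝ) / 2 - w) *
          (x ^ 2 - (1 + ε₀) ^ ((5 : ℝ) / 2 - 3 * w) * (c * ((x - δ) / (1 - δ)) ^ 3) *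
            (m * (c * ((x - δ) / (1 - δ)) ^ 3) + θ)) < 0)
    (hν : 0 < ν) (hs : 0 < s)
    (hinit : ∀ i k, X i k 0 = if k = 0 then X₀ i else 0)
    (hlow : ∀ i k, k < 0 → ∀ t, X i k t = 0)
    (hbd : ∃ M : ℝ, ∀ (t : ℝ) (i : Fin 4) (k : ℤ), (1 + (1 + ε₀) ^ ((10 : ℝ) * k)) * |X i k t| ≤ M)
    (hcont : ∀ i k, Continuous (X i k))
    (hder : ∀ i k, ∀ t ∈ Icc (0 : ℝ) s, HasDerivWithinAt (X i k)
      (quadTerm ε₀ dyadicTable X i k t - ν * (1 + ε₀) ^ ((2 : ℝ) * k) * X i k t) (Icc 0 s) t)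
    (hnonneg : ∀ t ∈ Icc (0 : ℝ) s, ∀ (i : Fin 4) (k : ℤ), 1 ≤ k → 0 ≤ X i k t) :
    ∀ n : ℕ, ∀ t ∈ Icc (0 : ℝ) s, (1 + ε₀) ^ (w * n) * |X 0 n t| ≤ (|X₀ 0| + 1) / δ := by
  set b : ℝ := 1 + ε₀ with hb
  have hb0 : 0 < b := by rw [hb]; linarith
  have hb1 : 1 < b := by rw [hb]; linarith
  have hδ1 : δ < 1 := hδθ.trans_le hθ1
  -- the sign of the datum shell and the sign-adjusted amplitudes
  set σ : ℝ := if 0 ≤ X₀ 0 then (1 : ℝ) else -1 with hσ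
  have hσsq : σ ^ 2 = 1 := by rw [hσ]; split_ifs <;> norm_num
  have hσabs : ∀ x : ℝ, 0 ≤ σ * x → σ * x = |x| := by
    intro x hx
    rw [hσ] at hx ⊢
    split_ifs at hx ⊢ with h
    · rw [one_mul] at hx ⊢; exact (abs_of_nonneg hx).symm
    · rw [abs_of_nonpos (by linarith)]; ring
  have hsign : ∀ t ∈ Icc (0 : ℝ) s, 0 ≤ σ * X 0 0 t := by
    rw [hσ]; exact dyadicTransport_shellZero_sign hε₀ hν.le hinit hlow hcont hder hnonneg
  set a : ℕ → ℝ → ℝ := fun k t => if k = 0 then σ * X 0 0 t else X 0 k t with ha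
  have ha0 : ∀ t, a 0 t = σ * X 0 0 t := fun t => by simp [ha]
  have hak : ∀ k, k ≠ 0 → ∀ t, a k t = X 0 k t := fun k hk t => by simp [ha, hk]
  have ha_nonneg : ∀ k, ∀ t ∈ Icc (0 : ℝ) s, 0 ≤ a k t := by
    intro k t ht
    rcases Nat.eq_zero_or_pos k with rfl | hk
    · rw [ha0]; exact hsign t ht
    · rw [hak k (Nat.pos_iff_ne_zero.1 hk)]
      exact hnonneg t ht 0 k (by exact_mod_cast hk)
  have ha_abs : ∀ k, ∀ t ∈ Icc (0 : ℝ) s, a k t = |X 0 k t| := by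
    intro k t ht
    rcases Nat.eq_zero_or_pos k with rfl | hk
    · rw [ha0, Nat.cast_zero]; exact hσabs _ (hsign t ht)
    · rw [hak k (Nat.pos_iff_ne_zero.1 hk)]
      exact (abs_of_nonneg (hnonneg t ht 0 k (by exact_mod_cast hk))).symm
  -- the scale
  set R : ℝ := (|X₀ 0| + 1) / δ with hR
  have hR0 : 0 < R := by rw [hR]; positivity
  -- the weighted variables, rates and coefficients
  set Y : ℕ → ℝ → ℝ := fun n t =>
    if n = 0 then 0 else b ^ (w * ((n : ℝ) - 1)) * a (n - 1) t / R with hY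
  set κ : ℕ → ℝ := fun n => ν * b ^ ((2 : ℝ) * ((n : ℝ) - 1)) with hκ
  set F : ℕ → ℝ := fun n => R * b ^ (((5 : ℝ) / 2 - w) * ((n : ℝ) - 1) - 5 / 2 + 2 * w) with hF
  have hY0 : ∀ t, Y 0 t = 0 := fun t => by simp [hY]
  have hYsucc : ∀ (k : ℕ) (t : ℝ), Y (k + 1) t = b ^ (w * (k : ℝ)) * a k t / R := by
    intro k t
    simp only [hY, Nat.succ_ne_zero, if_false, Nat.cast_succ, add_sub_cancel_right,
      Nat.add_sub_cancel]
  -- positivity, continuity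
  have hpos : ∀ n, ∀ t ∈ Icc (0 : ℝ) s, 0 ≤ Y n t := by
    intro n t ht
    rcases Nat.eq_zero_or_pos n with rfl | hn
    · rw [hY0]
    · obtain ⟨k, rfl⟩ : ∃ k, n = k + 1 := ⟨n - 1, by omega⟩
      rw [hYsucc]
      exact div_nonneg (mul_nonneg (Real.rpow_nonneg hb0.le _) (ha_nonneg k t ht)) hR0.le
  have ha_cont : ∀ k, Continuous (a k) := by
    intro k
    rcases Nat.eq_zero_or_pos k with rfl | hk
    · have h1 : a 0 = fun t => σ * X 0 0 t := funext (ha0)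
      rw [h1]; exact continuous_const.mul (hcont 0 0)
    · have h1 : a k = X 0 k := funext (hak k (Nat.pos_iff_ne_zero.1 hk))
      rw [h1]; exact hcont 0 k
  have hYcont : ∀ n, ContinuousOn (Y n) (Icc 0 s) := by
    intro n
    rcases Nat.eq_zero_or_pos n with rfl | hn
    · exact continuousOn_const.congr fun t _ => hY0 t
    · obtain ⟨k, rfl⟩ : ∃ k, n = k + 1 := ⟨n - 1, by omega⟩
      have : Continuous fun t => b ^ (w * (k : ℝ)) * a k t / R :=
        (continuous_const.mul (ha_cont k)).div_const R
      exact this.continuousOn.congr fun t _ => hYsucc k t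
  -- initial values
  have hYinit : ∀ n, Y n 0 ≤ δ := by
    intro n
    rcases Nat.eq_zero_or_pos n with rfl | hn
    · rw [hY0]; exact hδ0.le
    · obtain ⟨k, rfl⟩ : ∃ k, n = k + 1 := ⟨n - 1, by omega⟩
      rw [hYsucc]
      rcases Nat.eq_zero_or_pos k with rfl | hk
      · have h0 : a 0 0 = |X₀ 0| := by
          rw [ha_abs 0 0 ⟨le_rfl, hs.le⟩, Nat.cast_zero, hinit 0 0, if_pos rfl]
        rw [Nat.cast_zero, mul_zero, Real.rpow_zero, one_mul, h0, hR, div_div_eq_mul_div,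
          div_le_iff₀ (by positivity)]
        nlinarith [abs_nonneg (X₀ 0)]
      · have h0 : a k 0 = 0 := by
          rw [hak k (Nat.pos_iff_ne_zero.1 hk), hinit 0 k, if_neg]
          exact_mod_cast (Nat.pos_iff_ne_zero.1 hk)
        rw [h0, mul_zero, zero_div]; exact hδ0.le
  -- smallness of the deep shells (Tao's weight bound (4.5))
  obtain ⟨M, hM⟩ := hbd
  have hM0 : 0 ≤ M := by
    have := hM 0 0 0
    have h2 : 0 ≤ (1 + (1 + ε₀) ^ ((10 : ℝ) * ((0 : ℤ) : ℝ))) * |X 0 0 0| :=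
      mul_nonneg (add_nonneg zero_le_one (Real.rpow_nonneg hb0.le _)) (abs_nonneg _)
    linarith
  have hsmall_k : ∀ (k : ℕ) (t : ℝ), b ^ (w * (k : ℝ)) * |X 0 k t| ≤
      (M + 1) * (b ^ (w - 10)) ^ k := by
    intro k t
    have h1 := hM t 0 k
    have hpk : 0 < b ^ ((10 : ℝ) * (k : ℝ)) := Real.rpow_pos_of_pos hb0 _
    have h2 : b ^ ((10 : ℝ) * (k : ℝ)) * |X 0 k t| ≤ M + 1 := by
      have : ((k : ℤ) : ℝ) = (k : ℝ) := by simp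
      rw [this] at h1
      nlinarith [abs_nonneg (X 0 (k : ℤ) t)]
    have h3 : b ^ (w * (k : ℝ)) = (b ^ (w - 10)) ^ k * b ^ ((10 : ℝ) * (k : ℝ)) := by
      rw [← Real.rpow_natCast, ← Real.rpow_mul hb0.le, ← Real.rpow_add hb0]
      congr 1; ring
    rw [h3, mul_assoc]
    calc (b ^ (w - 10)) ^ k * (b ^ ((10 : ℝ) * (k : ℝ)) * |X 0 (k : ℤ) t|)
        ≤ (b ^ (w - 10)) ^ k * (M + 1) := mul_le_mul_of_nonneg_left h2 (by positivity)
      _ = (M + 1) * (b ^ (w - 10)) ^ k := by ring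
  have hr1 : b ^ (w - 10) < 1 := Real.rpow_lt_one_of_one_lt_of_neg hb1 (by linarith)
  have hr0 : 0 < b ^ (w - 10) := Real.rpow_pos_of_pos hb0 _
  obtain ⟨N₀, hN₀⟩ := exists_pow_lt_of_lt_one (div_pos (mul_pos hδ0 hR0) (by linarith : 0 < M + 1))
    hr1
  have hsmall : ∀ n, N₀ < n → ∀ t ∈ Icc (0 : ℝ) s, Y n t ≤ δ := by
    intro n hn t ht
    obtain ⟨k, rfl⟩ : ∃ k, n = k + 1 := ⟨n - 1, by omega⟩
    rw [hYsucc, ha_abs k t ht, div_le_iff₀ hR0]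
    have hk : N₀ ≤ k := by omega
    have hpow : (b ^ (w - 10)) ^ k ≤ (b ^ (w - 10)) ^ N₀ := pow_le_pow_of_le_one hr0.le hr1.le hk
    calc b ^ (w * (k : ℝ)) * |X 0 (k : ℤ) t| ≤ (M + 1) * (b ^ (w - 10)) ^ k := hsmall_k k t
      _ ≤ (M + 1) * (b ^ (w - 10)) ^ N₀ := mul_le_mul_of_nonneg_left hpow (by linarith)
      _ ≤ (M + 1) * (δ * R / (M + 1)) := mul_le_mul_of_nonneg_left hN₀.le (by linarith)
      _ = δ * R := by field_simp
  -- the equations of motion in the weighted variables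
  have hderY : ∀ n, 1 ≤ n → ∀ t ∈ Ico (0 : ℝ) s, HasDerivWithinAt (Y n)
      (-κ n * Y n t + F n * (Y (n - 1) t ^ 2 - b ^ ((5 : ℝ) / 2 - 3 * w) * Y n t * Y (n + 1) t))
      (Ici t) t := by
    intro n hn t ht
    obtain ⟨k, rfl⟩ : ∃ k, n = k + 1 := ⟨n - 1, by omega⟩
    have hts : t ∈ Icc (0 : ℝ) s := ⟨ht.1, ht.2.le⟩
    have hnhd : Icc 0 s ∈ 𝓝[Ici t] t :=
      mem_of_superset (Icc_mem_nhdsGE ht.2) (Icc_subset_Icc ht.1 le_rfl)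
    -- the derivative of `a k` within `[0,s]`
    set P : ℝ := if k = 0 then 0 else a (k - 1) t with hP
    have hda : HasDerivWithinAt (a k)
        (b ^ ((5 : ℝ) * ((k : ℝ) - 1) / 2) * P ^ 2 - b ^ ((5 : ℝ) * (k : ℝ) / 2) *
          (a k t * a (k + 1) t) - ν * b ^ ((2 : ℝ) * (k : ℝ)) * a k t) (Icc 0 s) t := by
      have hX := hder 0 k t hts
      rw [quadTerm_dyadicTable_zero, ← hb] at hX
      have hk1 : X 0 ((k : ℤ) + 1) t = a (k + 1) t := by
        rw [hak (k + 1) (Nat.succ_ne_zero k)]; push_cast; rfl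
      rcases Nat.eq_zero_or_pos k with rfl | hkpos
      · -- the datum shell: `a 0 = σ X_{0,0}`, no feed
        have hm1 : X 0 ((0 : ℕ) - 1 : ℤ) t = 0 := hlow 0 _ (by norm_num) t
        have hfun : a 0 = fun u => σ * X 0 0 u := funext ha0
        rw [hfun]
        beta_reduce
        refine (hX.const_mul σ).congr_deriv ?_
        rw [hP, if_pos rfl, hm1, hk1]
        push_cast
        ring
      · have hkne : k ≠ 0 := Nat.pos_iff_ne_zero.1 hkpos
        have hfun : a k = X 0 k := funext (hak k hkne)
        rw [hfun]
        refine hX.congr_deriv ?_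
        have hprev : X 0 ((k : ℤ) - 1) t ^ 2 = P ^ 2 := by
          rw [hP, if_neg hkne]
          by_cases hk1' : k = 1
          · subst hk1'
            rw [ha0, mul_pow, hσsq, one_mul]
            push_cast
            ring_nf
          · have hne : k - 1 ≠ 0 := by omega
            rw [hak (k - 1) hne]
            have : ((k : ℤ) - 1) = ((k - 1 : ℕ) : ℤ) := by omega
            rw [this]
        have hcur : X 0 (k : ℤ) t = a k t := (hak k hkne t).symm
        rw [hprev, hk1, hcur]
        push_cast
        ring
    -- pass to the weighted variable
    have hdaI : HasDerivWithinAt (a k) _ (Ici t) t := hda.mono_of_mem_nhdsWithin hnhd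
    have hdY := (hdaI.const_mul (b ^ (w * (k : ℝ)))).div_const R
    have hfunY : Y (k + 1) = fun u => b ^ (w * (k : ℝ)) * a k u / R := by
      funext u; exact hYsucc k u
    rw [hfunY]
    refine hdY.congr_deriv ?_
    -- the bookkeeping identity
    have hid := dyadicTransport_identity (P := P) (Q := a k t) (S := a (k + 1) t) (w := w) (ν := ν)
      hb0 hR0.ne' (k : ℝ)
    have hYk : Y (k + 1) t = b ^ (w * (k : ℝ)) * a k t / R := hYsucc k t
    have hYk1 : Y (k + 1 + 1) t = b ^ (w * ((k : ℝ) + 1)) * a (k + 1) t / R := by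
      rw [hYsucc, Nat.cast_succ]
    have hYkm : Y (k + 1 - 1) t ^ 2 = (b ^ (w * ((k : ℝ) - 1)) * P / R) ^ 2 := by
      rw [Nat.add_sub_cancel, hP]
      rcases Nat.eq_zero_or_pos k with rfl | hkpos
      · rw [hY0, if_pos rfl]; simp
      · obtain ⟨j, rfl⟩ : ∃ j, k = j + 1 := ⟨k - 1, by omega⟩
        rw [hYsucc, if_neg (Nat.succ_ne_zero j), Nat.add_sub_cancel, Nat.cast_succ,
          add_sub_cancel_right]
    have hκk : κ (k + 1) = ν * b ^ ((2 : ℝ) * (k : ℝ)) := by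
      show ν * b ^ ((2 : ℝ) * (((k + 1 : ℕ) : ℝ) - 1)) = ν * b ^ ((2 : ℝ) * (k : ℝ))
      rw [Nat.cast_succ, add_sub_cancel_right]
    have hFk : F (k + 1) = R * b ^ (((5 : ℝ) / 2 - w) * (k : ℝ) - 5 / 2 + 2 * w) := by
      show R * b ^ (((5 : ℝ) / 2 - w) * (((k + 1 : ℕ) : ℝ) - 1) - 5 / 2 + 2 * w) =
        R * b ^ (((5 : ℝ) / 2 - w) * (k : ℝ) - 5 / 2 + 2 * w)
      rw [Nat.cast_succ, add_sub_cancel_right]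
    rw [hYkm, hYk1, hκk, hFk]
    beta_reduce
    exact hid
  -- rates and coefficients
  have hκpos : ∀ n, 0 < κ n := fun n => mul_pos hν (Real.rpow_pos_of_pos hb0 _)
  have hκmono : ∀ n, κ n ≤ κ (n + 1) := by
    intro n
    simp only [hκ]
    apply mul_le_mul_of_nonneg_left _ hν.le
    apply Real.rpow_le_rpow_of_exponent_le hb1.le
    push_cast; linarith
  have hκV : ∀ n, κ (n + 1) ≤ b ^ (2 : ℝ) * κ n := by
    intro n
    simp only [hκ]
    rw [show b ^ (2 : ℝ) * (ν * b ^ ((2 : ℝ) * ((n : ℝ) - 1))) =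
      ν * (b ^ (2 : ℝ) * b ^ ((2 : ℝ) * ((n : ℝ) - 1))) by ring, ← Real.rpow_add hb0]
    push_cast
    apply le_of_eq; congr 2; ring
  have hFpos : ∀ n, 0 < F n := fun n => mul_pos hR0 (Real.rpow_pos_of_pos hb0 _)
  have hFK : ∀ n, F (n + 1) = b ^ ((5 : ℝ) / 2 - w) * F n := by
    intro n
    simp only [hF]
    rw [show b ^ ((5 : ℝ) / 2 - w) * (R * b ^ (((5 : ℝ) / 2 - w) * ((n : ℝ) - 1) - 5 / 2 + 2 * w)) =
      R * (b ^ ((5 : ℝ) / 2 - w) * b ^ (((5 : ℝ) / 2 - w) * ((n : ℝ) - 1) - 5 / 2 + 2 * w)) by ring,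
      ← Real.rpow_add hb0]
    push_cast
    congr 2; ring
  have hK : 0 < b ^ ((5 : ℝ) / 2 - w) := Real.rpow_pos_of_pos hb0 _
  have hD : 0 < b ^ ((5 : ℝ) / 2 - 3 * w) := Real.rpow_pos_of_pos hb0 _
  -- the region theorem
  have hreg := dyadicRegion_le_one (Y := Y) (κ := κ) (F := F) (N₀ := N₀) hs hκpos hκmono hκV
    hFpos hFK hK hD hc0 hDc hδ0 hδθ hθ1 hm hVδ hψ₁ hψ₂ hY0 hYcont hderY hpos hsmall hYinit
  -- conclusion
  intro n t ht
  have h1 := hreg (n + 1) t ht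
  rw [hYsucc, ha_abs n t ht, div_le_one hR0] at h1
  exact h1

/-- **Certificate ⇒ no Theorem 4.2-level blow-up of the dyadic member at ratio `1+ε₀`.**  With
`w > 1/2` the weighted bound of `dyadicTransport_weightBound` is the hypothesis of the socket
`not_noGlobalCascade_dyadicTable_of_weightBound`; hence, under the certificate facts for
`(ε₀, w, δ, θ, m, c)`, `∀ X₀, ¬ NoGlobalCascade ε₀ dyadicTable X₀`.  MODEL lattice statement; the
certificate itself (two one-variable inequalities and two numerical conditions) is discharged
ratio by ratio elsewhere. [this file] -/
theorem not_noGlobalCascade_dyadicTable_of_certificate {ε₀ w δ θ m c : ℝ}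
    (hε₀ : 0 < ε₀) (hw : 1 / 2 < w) (hw1 : w ≤ 1)
    (hδ0 : 0 < δ) (hδθ : δ < θ) (hθ1 : θ ≤ 1) (hm : 0 ≤ m) (hc0 : 0 < c)
    (hDc : 1 ≤ (1 + ε₀) ^ ((5 : ℝ) / 2 - 3 * w) * c)
    (hVδ : (1 + ε₀) ^ (2 : ℝ) * (1 - δ) ≤ 3)
    (hψ₁ : ∀ x : ℝ, 0 ≤ x → m * x + θ ≤ 1 →
      (1 + ε₀) ^ ((5 : ℝ) / 2 - w) *
          (x ^ 2 - (1 + ε₀) ^ ((5 : ℝ) / 2 - 3 * w) * (m * x + θ) *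
            (c * ((m * x + θ - δ) / (1 - δ)) ^ 3)) +
        m * (1 + ε₀) ^ ((5 : ℝ) / 2 - 3 * w) * x * (m * x + θ) ≤ 0)
    (hψ₂ : ∀ x : ℝ, δ < x → x ≤ 1 →
      3 * c * ((x - δ) / (1 - δ)) ^ 2 / (1 - δ) *
          (1 - (1 + ε₀) ^ ((5 : ℝ) / 2 - 3 * w) * x * (c * ((x - δ) / (1 - δ)) ^ 3)) -
        (1 + ε₀) ^ ((5 : ℝ) / 2 - w) *
          (x ^ 2 - (1 + ε₀) ^ ((5 : ℝ) / 2 - 3 * w) * (c * ((x - δ) / (1 - δ)) ^ 3) *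
            (m * (c * ((x - δ) / (1 - δ)) ^ 3) + θ)) < 0) :
    ∀ X₀ : Fin 4 → ℝ, ¬ NoGlobalCascade ε₀ dyadicTable X₀ := by
  intro X₀
  refine not_noGlobalCascade_dyadicTable_of_weightBound hε₀ fun ν hν => ?_
  refine ⟨w, (|X₀ 0| + 1) / δ, hw, fun s hs X hinit hlow hbd hcont hder hnonneg => ?_⟩
  exact dyadicTransport_weightBound hε₀ hw1 hδ0 hδθ hθ1 hm hc0 hDc hVδ hψ₁ hψ₂ hν hs
    hinit hlow hbd hcont hder hnonneg

end Summit.NavierStokesRegularity.NavierStokesRegularity.Theorems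

end
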